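import Summits.HodgeConjecture.HodgeConjecture.Theorems.F0P3cStCharTSEllCartanCompactH     -- F-B (this seat): (t2) `exists_centralizer_eq_map_splitTorusH_of_not_isCompact`; brings F-A (t1)(t3) and ★ CartanFinTwo (compact half)
import Summits.HodgeConjecture.HodgeConjecture.Theorems.F0P3cStCharTSUpTrCartanFields      -- ★ p852… (LH4-p01 (g8)) UP-TR (H3b) «CARTAN-FIELDS-H»: `centralizer_eq_of_mem_centralizer_of_isLocalGRegular`
import Literature.NumberTheory.Rogawski1990.GRegularLocalisation                         -- ★ `isLocalGRegular_of_isConj`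
import HarnessLib

/-!
# F0 · P3c · ROAD «UP-TR» (H1) — «CARTAN-ALL-H★»: a SET OF REPRESENTATIVES of the conjugacy classes of Cartan subgroups of the endoscopic group
# `H_v = U(Φ₂)(L⁺_v) × U(Φ₁)(L⁺_v)` with the split torus `M_H = M₂ × U(Φ₁)(L⁺_v)` singled out [Rogawski1990, §3.6 pp. 28–31; §12.5 pp. 182–184]

Cell `pub/hodgecm-mathlib`, crux H413 = `stmt-HodgeConjecture-24833` (lane `--supports … --as helper`), route HCCMUnconditional; ROAD «UP-TR» (LEAD F0P3a-plan (g15) T14-21 «A»,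
holder ∕ dealer F0P3-p02 (g23); CENSUS-UPTR v1 §3 (H1)), brick (H1) «CARTAN-ALL-H», HEAD FILE F-D of the census `F0/P3a/F0P3a-p03/g26/h1/CENSUS-H1-CartanAllH.v1.F0P3ap03g26.md`;
sigsheet boxed «=» by ref5 (g13) R-794 (token tie with ★ `exists_cartanAll` under the three substitutions; ask: ship the `_weylShape` corollary — §2 below); seat F0P3a-p03 (g26).
THEOREMS ONLY (no definition ∕ instance ∕ notation ∕ named fact ∕ `sorry`); ★-only imports.

WHAT.  `H_v = H₂ × H₁`, `H₂ = U(Φ₂)(L⁺_v) = (cmDatum L 2 Φ₂).Local v`, `H₁ = U(Φ₁)(L⁺_v)`, `v` a finite place of `L⁺` NON-SPLIT in the CM field `L`; `M_H = M₂ × H₁`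
(`M₂ = (cmBorelTriple L 2 v).M` the diagonal torus of `H₂`).  **`exists_cartanAllH`**: a finite set `cartanAllH` of subgroups of `H_v` with (1) `M_H ∈ cartanAllH`; (2) every member
is the centraliser of a `G`-REGULAR element (★ `IsLocalGRegular`); (3) every member other than `M_H` is compact; (4) COMPLETENESS — the centraliser of every `G`-regular `γ`
is `Ad(u) T` for some `T ∈ cartanAllH`; (5) IRREDUNDANCY — conjugate members are equal.  = the five clauses of ★ `F0P3cStCharTSCartanAll.exists_cartanAll` TOKEN FOR TOKEN
under `Gqs L v ↦ H_v`, `(cmBorelTriple L 3 v).M ↦ M_H`, `IsRegularElt ↦ IsLocalGRegular L v`.  PROOF = composition of ★ names, exactly as the `G`-file: `SH` := ★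
`cartanEllH_of_cartanFin_two_measureFree (exists_finset_cartanSubgroups_two L v hns)` (compact representatives `Z_H(γ₀)`, `γ₀` `G`-regular, complete among compact
centralisers, pairwise non-conjugate; F0P2-p01 (g22) over CARTAN-FIN at rank 2); `cartanAllH := insert M_H SH`; `M_H = Z_H((diag(ϖ, σ(ϖ)⁻¹), 1))` (F-A
`exists_isLocalGRegular_centralizer_eq_splitTorusH`); a non-compact `Z_H(γ)` is `Ad(u) M_H` (F-B `exists_centralizer_eq_map_splitTorusH_of_not_isCompact`); `M_H` is
non-compact (F-A `not_isCompact_splitTorusH`) and compactness is conjugation-invariant (★ `isCompact_coe_map_conj_iff`), so `M_H` is conjugate to no member of `SH`.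
§2 `exists_cartanAllH_weylShape` — the same in the letters of the Weyl-integration cover (conjugacy `∀ g, g ∈ Z(γ) ↔ x⁻¹ g x ∈ T`, irredundancy
`T ≠ T' → ∀ y, ¬ ∀ h, h ∈ T' ↔ y⁻¹ h y ∈ T`), by the 8 generic proof lines of ★ `exists_cartanAll_weylShape` — the (H5) WIF-H head (F0P3a-p05 (g24)) binds `(SHall) (hS) (hcov) (hnc)`
from it by bare projection (ref5 R-794∕R-795 kernel ties).  §3 `exists_cartanAllH_classShape` — ELEMENT letters (`hcomplete`: every `G`-regular `h` is conjugate into a member;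
`hirred`: members containing conjugate `G`-regular elements are equal), the shape bound by the holder's (N5) ★-to-be `weighted_fibre_sum_eq` (★ (H3b) swap inside).
HONEST LABEL: count-neutral; block consequents 11 → 10 → 9 only at the rider editions; organs 2 = 2; h413 registry untouched; HC_CM is proved only modulo the printed
citations until rung 0 closes.

## References
* [Rogawski1990] J. D. Rogawski, *Automorphic Representations of Unitary Groups in Three Variables*, Ann. of Math. Stud. 123 (1990): §3.6 pp. 28–31 (Cartan subgroups of
  `U(2) × U(1)` and `U(3)`: the split torus and the compact ones), §4.3 p. 42 (`G`-regular elements of `H`), §12.5 pp. 182–184 («a set of representatives for the conjugacy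
  classes of Cartan subgroups»; elliptic tori of `H`, normalised measures).
* [PlatonovRapinchuk1994] V. Platonov, A. Rapinchuk, *Algebraic Groups and Number Theory* (1994), §6.4 Cor. 1 (finiteness of conjugacy classes of maximal tori over local fields), §3.3.
-/

set_option autoImplicit false
-- the mandated namespace has the single-problem summit's repeated segment (`HodgeConjecture.HodgeConjecture`)
set_option linter.dupNamespace false

noncomputable section

open NumberField IsDedekindDomain
open scoped Matrix MatrixGroups
open Literature.NumberTheory.Rogawski1990 Literature.NumberTheory.Automorphic Literature.NumberTheory.Automorphic.UnitaryGroup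
open Summit.HodgeConjecture.HodgeConjecture.Cruxes.H413.F0P3cStCharTSCartanEllProd
open Summit.HodgeConjecture.HodgeConjecture.Cruxes.H413.F0P3cStCharTSCartanEllH (cartanEllH_of_cartanFin_two_measureFree)
open Summit.HodgeConjecture.HodgeConjecture.Cruxes.H413.F0P3cStCharTSCartanFinTwo (exists_finset_cartanSubgroups_two)
open Summit.HodgeConjecture.HodgeConjecture.Cruxes.H413.F0P3cStCharTSCartanSplitTwoH (exists_isLocalGRegular_centralizer_eq_splitTorusH not_isCompact_splitTorusH)
open Summit.HodgeConjecture.HodgeConjecture.Cruxes.H413.F0P3cStCharTSEllCartanCompactH (exists_centralizer_eq_map_splitTorusH_of_not_isCompact)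

namespace Summit.HodgeConjecture.HodgeConjecture.Cruxes.H413.F0P3cStCharTSCartanAllH

variable (L : Type) [Field L] [NumberField L] [IsCMField L] (v : HeightOneSpectrum (𝓞 ↥(maximalRealSubfield L)))

set_option maxHeartbeats 800000 in  -- statement-level `whnf` on the CM carriers, as in ★ CartanReps ∕ CartanFinTwo
/-- **«CARTAN-ALL-H★» — a set of representatives of the conjugacy classes of Cartan subgroups of `H_v = U(Φ₂)(L⁺_v) × U(Φ₁)(L⁺_v)` containing the split torus
`M_H = M₂ × U(Φ₁)(L⁺_v)`** (`v` non-split): `M_H ∈ cartanAllH`, every member is `Z_H(γ₀)` with `γ₀` `G`-regular, every member `≠ M_H` is compact, the centraliser of every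
`G`-regular element is conjugate to a member, and conjugate members are equal.  The `H_v` twin of ★ `F0P3cStCharTSCartanAll.exists_cartanAll`, five clauses token for token.
[cite: Rogawski1990, §3.6 pp. 28–31; §12.5 pp. 182–184] [cite: PlatonovRapinchuk1994, §6.4 Cor. 1] -/
theorem exists_cartanAllH (hns : ∀ w : PlacesOver L v, IsCMField.complexConj L • w.1 = w.1) :
    ∃ cartanAllH : Finset (Subgroup ((UnitaryGroup.cmDatum L 2 (Matrix.of fun i j : Fin 2 => if i.val + j.val + 1 = 2 then (1 : L) else 0)).Local v ×
        (UnitaryGroup.cmDatum L 1 (Matrix.of fun i j : Fin 1 => if i.val + j.val + 1 = 1 then (1 : L) else 0)).Local v)),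
      ((cmBorelTriple L 2 v).M).prod ⊤ ∈ cartanAllH ∧
      (∀ T ∈ cartanAllH, ∃ γ₀ : (UnitaryGroup.cmDatum L 2 (Matrix.of fun i j : Fin 2 => if i.val + j.val + 1 = 2 then (1 : L) else 0)).Local v ×
          (UnitaryGroup.cmDatum L 1 (Matrix.of fun i j : Fin 1 => if i.val + j.val + 1 = 1 then (1 : L) else 0)).Local v,
        IsLocalGRegular L v γ₀ ∧ T = Subgroup.centralizer ({γ₀} : Set ((UnitaryGroup.cmDatum L 2 (Matrix.of fun i j : Fin 2 => if i.val + j.val + 1 = 2 then (1 : L) else 0)).Local v ×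
          (UnitaryGroup.cmDatum L 1 (Matrix.of fun i j : Fin 1 => if i.val + j.val + 1 = 1 then (1 : L) else 0)).Local v))) ∧
      (∀ T ∈ cartanAllH, T ≠ ((cmBorelTriple L 2 v).M).prod ⊤ →
        IsCompact (T : Set ((UnitaryGroup.cmDatum L 2 (Matrix.of fun i j : Fin 2 => if i.val + j.val + 1 = 2 then (1 : L) else 0)).Local v ×
          (UnitaryGroup.cmDatum L 1 (Matrix.of fun i j : Fin 1 => if i.val + j.val + 1 = 1 then (1 : L) else 0)).Local v))) ∧
      (∀ γ : (UnitaryGroup.cmDatum L 2 (Matrix.of fun i j : Fin 2 => if i.val + j.val + 1 = 2 then (1 : L) else 0)).Local v ×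
          (UnitaryGroup.cmDatum L 1 (Matrix.of fun i j : Fin 1 => if i.val + j.val + 1 = 1 then (1 : L) else 0)).Local v,
        IsLocalGRegular L v γ →
        ∃ T ∈ cartanAllH, ∃ u : (UnitaryGroup.cmDatum L 2 (Matrix.of fun i j : Fin 2 => if i.val + j.val + 1 = 2 then (1 : L) else 0)).Local v ×
            (UnitaryGroup.cmDatum L 1 (Matrix.of fun i j : Fin 1 => if i.val + j.val + 1 = 1 then (1 : L) else 0)).Local v,
          Subgroup.centralizer ({γ} : Set ((UnitaryGroup.cmDatum L 2 (Matrix.of fun i j : Fin 2 => if i.val + j.val + 1 = 2 then (1 : L) else 0)).Local v ×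
            (UnitaryGroup.cmDatum L 1 (Matrix.of fun i j : Fin 1 => if i.val + j.val + 1 = 1 then (1 : L) else 0)).Local v)) = T.map (MulAut.conj u).toMonoidHom) ∧
      (∀ T ∈ cartanAllH, ∀ T' ∈ cartanAllH,
        (∃ x : (UnitaryGroup.cmDatum L 2 (Matrix.of fun i j : Fin 2 => if i.val + j.val + 1 = 2 then (1 : L) else 0)).Local v ×
            (UnitaryGroup.cmDatum L 1 (Matrix.of fun i j : Fin 1 => if i.val + j.val + 1 = 1 then (1 : L) else 0)).Local v,
          T.map (MulAut.conj x).toMonoidHom = T') → T = T') := by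
  classical
  obtain ⟨SH, hSH, hcov, hdist⟩ := cartanEllH_of_cartanFin_two_measureFree L v hns (exists_finset_cartanSubgroups_two L v hns)
  obtain ⟨m₀, hm₀reg, -, -, hZm₀⟩ := exists_isLocalGRegular_centralizer_eq_splitTorusH L v hns
  -- the split torus `M_H` is NOT compact
  have hMnc := not_isCompact_splitTorusH L v hns
  refine ⟨insert (((cmBorelTriple L 2 v).M).prod ⊤) SH, Finset.mem_insert_self _ _, ?_, ?_, ?_, ?_⟩
  · intro T hT
    rcases Finset.mem_insert.1 hT with rfl | hT'
    · exact ⟨m₀, hm₀reg, hZm₀.symm⟩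
    · exact (hSH T hT').2
  · intro T hT hTM
    rcases Finset.mem_insert.1 hT with rfl | hT'
    · exact absurd rfl hTM
    · exact (hSH T hT').1
  · intro γ hreg
    by_cases hc : IsCompact ((Subgroup.centralizer ({γ} : Set ((UnitaryGroup.cmDatum L 2 (Matrix.of fun i j : Fin 2 => if i.val + j.val + 1 = 2 then (1 : L) else 0)).Local v ×
        (UnitaryGroup.cmDatum L 1 (Matrix.of fun i j : Fin 1 => if i.val + j.val + 1 = 1 then (1 : L) else 0)).Local v))) : Set ((UnitaryGroup.cmDatum L 2 (Matrix.of fun i j : Fin 2 => if i.val + j.val + 1 = 2 then (1 : L) else 0)).Local v ×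
        (UnitaryGroup.cmDatum L 1 (Matrix.of fun i j : Fin 1 => if i.val + j.val + 1 = 1 then (1 : L) else 0)).Local v))
    · obtain ⟨T, hT, x, hx⟩ := hcov γ hreg hc
      refine ⟨T, Finset.mem_insert_of_mem hT, x⁻¹, ?_⟩
      -- `Z(x γ x⁻¹) = T` ⇒ `Z(γ) = Ad(x⁻¹) T`
      rw [← hx, ← F0P3cStCharTSCartanEllProd.centralizer_singleton_conj_eq_map]
      congr 2
      group
    · obtain ⟨u, hu⟩ := exists_centralizer_eq_map_splitTorusH_of_not_isCompact L v hns γ hreg hc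
      exact ⟨((cmBorelTriple L 2 v).M).prod ⊤, Finset.mem_insert_self _ _, u, hu⟩
  · intro T hT T' hT' hconj
    rcases Finset.mem_insert.1 hT with rfl | hTS <;> rcases Finset.mem_insert.1 hT' with rfl | hT'S
    · rfl
    · -- `M_H` conjugate to a compact member: impossible
      obtain ⟨x, hx⟩ := hconj
      exact absurd ((isCompact_coe_map_conj_iff _ x).1 (hx ▸ (hSH T' hT'S).1)) hMnc
    · obtain ⟨x, hx⟩ := hconj
      have hTc : IsCompact (T : Set ((UnitaryGroup.cmDatum L 2 (Matrix.of fun i j : Fin 2 => if i.val + j.val + 1 = 2 then (1 : L) else 0)).Local v ×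
          (UnitaryGroup.cmDatum L 1 (Matrix.of fun i j : Fin 1 => if i.val + j.val + 1 = 1 then (1 : L) else 0)).Local v)) := (hSH T hTS).1
      exact absurd ((isCompact_coe_map_conj_iff T x).2 hTc) (hx ▸ hMnc)
    · exact hdist T hTS T' hT'S hconj

set_option maxHeartbeats 800000 in  -- statement-level `whnf` on the CM carriers
/-- **«CARTAN-ALL-H★» in the letters of the Weyl-integration cover** (the (H5) WIF-H head's `(SHall) (hS) (hcov) (hnc)`, as ★ (E4)
`weylIntegrationFormula_of_cartanFinset_of_tubeJacobians` binds ★ `exists_cartanAll_weylShape`): the same family, with conjugacy written as `∀ g, g ∈ Z_H(γ) ↔ x⁻¹ g x ∈ T` and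
irredundancy as `T ≠ T' → ∀ y, ¬ (∀ h, h ∈ T' ↔ y⁻¹ h y ∈ T)`.  The eight generic proof lines of ★ `exists_cartanAll_weylShape`. [cite: Rogawski1990, §12.5 p. 182; §3.6 pp. 28–31] -/
theorem exists_cartanAllH_weylShape (hns : ∀ w : PlacesOver L v, IsCMField.complexConj L • w.1 = w.1) :
    ∃ cartanAllH : Finset (Subgroup ((UnitaryGroup.cmDatum L 2 (Matrix.of fun i j : Fin 2 => if i.val + j.val + 1 = 2 then (1 : L) else 0)).Local v ×
        (UnitaryGroup.cmDatum L 1 (Matrix.of fun i j : Fin 1 => if i.val + j.val + 1 = 1 then (1 : L) else 0)).Local v)),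
      ((cmBorelTriple L 2 v).M).prod ⊤ ∈ cartanAllH ∧
      (∀ T ∈ cartanAllH, ∃ γ₀ : (UnitaryGroup.cmDatum L 2 (Matrix.of fun i j : Fin 2 => if i.val + j.val + 1 = 2 then (1 : L) else 0)).Local v ×
          (UnitaryGroup.cmDatum L 1 (Matrix.of fun i j : Fin 1 => if i.val + j.val + 1 = 1 then (1 : L) else 0)).Local v,
        IsLocalGRegular L v γ₀ ∧ T = Subgroup.centralizer ({γ₀} : Set ((UnitaryGroup.cmDatum L 2 (Matrix.of fun i j : Fin 2 => if i.val + j.val + 1 = 2 then (1 : L) else 0)).Local v ×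
          (UnitaryGroup.cmDatum L 1 (Matrix.of fun i j : Fin 1 => if i.val + j.val + 1 = 1 then (1 : L) else 0)).Local v))) ∧
      (∀ T ∈ cartanAllH, T ≠ ((cmBorelTriple L 2 v).M).prod ⊤ →
        IsCompact (T : Set ((UnitaryGroup.cmDatum L 2 (Matrix.of fun i j : Fin 2 => if i.val + j.val + 1 = 2 then (1 : L) else 0)).Local v ×
          (UnitaryGroup.cmDatum L 1 (Matrix.of fun i j : Fin 1 => if i.val + j.val + 1 = 1 then (1 : L) else 0)).Local v))) ∧
      (∀ γ : (UnitaryGroup.cmDatum L 2 (Matrix.of fun i j : Fin 2 => if i.val + j.val + 1 = 2 then (1 : L) else 0)).Local v ×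
          (UnitaryGroup.cmDatum L 1 (Matrix.of fun i j : Fin 1 => if i.val + j.val + 1 = 1 then (1 : L) else 0)).Local v,
        IsLocalGRegular L v γ →
        ∃ T ∈ cartanAllH, ∃ x : (UnitaryGroup.cmDatum L 2 (Matrix.of fun i j : Fin 2 => if i.val + j.val + 1 = 2 then (1 : L) else 0)).Local v ×
            (UnitaryGroup.cmDatum L 1 (Matrix.of fun i j : Fin 1 => if i.val + j.val + 1 = 1 then (1 : L) else 0)).Local v,
          ∀ g : (UnitaryGroup.cmDatum L 2 (Matrix.of fun i j : Fin 2 => if i.val + j.val + 1 = 2 then (1 : L) else 0)).Local v ×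
              (UnitaryGroup.cmDatum L 1 (Matrix.of fun i j : Fin 1 => if i.val + j.val + 1 = 1 then (1 : L) else 0)).Local v,
            g ∈ Subgroup.centralizer ({γ} : Set ((UnitaryGroup.cmDatum L 2 (Matrix.of fun i j : Fin 2 => if i.val + j.val + 1 = 2 then (1 : L) else 0)).Local v ×
              (UnitaryGroup.cmDatum L 1 (Matrix.of fun i j : Fin 1 => if i.val + j.val + 1 = 1 then (1 : L) else 0)).Local v)) ↔ x⁻¹ * g * x ∈ T) ∧
      (∀ T ∈ cartanAllH, ∀ T' ∈ cartanAllH, T ≠ T' → ∀ y : (UnitaryGroup.cmDatum L 2 (Matrix.of fun i j : Fin 2 => if i.val + j.val + 1 = 2 then (1 : L) else 0)).Local v ×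
          (UnitaryGroup.cmDatum L 1 (Matrix.of fun i j : Fin 1 => if i.val + j.val + 1 = 1 then (1 : L) else 0)).Local v,
        ¬ ∀ h : (UnitaryGroup.cmDatum L 2 (Matrix.of fun i j : Fin 2 => if i.val + j.val + 1 = 2 then (1 : L) else 0)).Local v ×
            (UnitaryGroup.cmDatum L 1 (Matrix.of fun i j : Fin 1 => if i.val + j.val + 1 = 1 then (1 : L) else 0)).Local v,
          h ∈ T' ↔ y⁻¹ * h * y ∈ T) := by
  obtain ⟨C, hM, hZ, hcpt, hcov, hirr⟩ := exists_cartanAllH L v hns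
  refine ⟨C, hM, hZ, hcpt, fun γ hreg => ?_, fun T hT T' hT' hne y hy => hne (hirr T hT T' hT' ⟨y, ?_⟩)⟩
  · obtain ⟨T, hT, u, hu⟩ := hcov γ hreg
    refine ⟨T, hT, u, fun g => ?_⟩
    rw [hu, Subgroup.mem_map_equiv, MulAut.conj_symm_apply]
  · ext h
    rw [Subgroup.mem_map_equiv, MulAut.conj_symm_apply]
    exact (hy h).symm


set_option maxHeartbeats 800000 in  -- statement-level `whnf` on the CM carriers
/-- **«CARTAN-ALL-H★» in ELEMENT letters** (the (N5) weighted-fibre-count head's `hcomplete` ∕ `hirred`, F0P3-p02 (g23)): every `G`-regular `h ∈ H_v` is conjugate to an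
element of some member (`h ∈ Z_H(h) = Ad(u) T`), and two members containing conjugate `G`-regular elements `s ∼ s′` are EQUAL (`Z_H(s) = T`, `Z_H(s′) = T′` by ★ (H3b)
`centralizer_eq_of_mem_centralizer_of_isLocalGRegular`, `Z_H(c s c⁻¹) = Ad(c) Z_H(s)`, then clause (5)). [cite: Rogawski1990, §12.5 pp. 182–183; §3.6 pp. 28–31] -/
theorem exists_cartanAllH_classShape (hns : ∀ w : PlacesOver L v, IsCMField.complexConj L • w.1 = w.1) :
    ∃ cartanAllH : Finset (Subgroup ((UnitaryGroup.cmDatum L 2 (Matrix.of fun i j : Fin 2 => if i.val + j.val + 1 = 2 then (1 : L) else 0)).Local v ×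
        (UnitaryGroup.cmDatum L 1 (Matrix.of fun i j : Fin 1 => if i.val + j.val + 1 = 1 then (1 : L) else 0)).Local v)),
      ((cmBorelTriple L 2 v).M).prod ⊤ ∈ cartanAllH ∧
      (∀ T ∈ cartanAllH, ∃ γ₀ : (UnitaryGroup.cmDatum L 2 (Matrix.of fun i j : Fin 2 => if i.val + j.val + 1 = 2 then (1 : L) else 0)).Local v ×
          (UnitaryGroup.cmDatum L 1 (Matrix.of fun i j : Fin 1 => if i.val + j.val + 1 = 1 then (1 : L) else 0)).Local v,
        IsLocalGRegular L v γ₀ ∧ T = Subgroup.centralizer ({γ₀} : Set ((UnitaryGroup.cmDatum L 2 (Matrix.of fun i j : Fin 2 => if i.val + j.val + 1 = 2 then (1 : L) else 0)).Local v ×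
          (UnitaryGroup.cmDatum L 1 (Matrix.of fun i j : Fin 1 => if i.val + j.val + 1 = 1 then (1 : L) else 0)).Local v))) ∧
      (∀ T ∈ cartanAllH, T ≠ ((cmBorelTriple L 2 v).M).prod ⊤ →
        IsCompact (T : Set ((UnitaryGroup.cmDatum L 2 (Matrix.of fun i j : Fin 2 => if i.val + j.val + 1 = 2 then (1 : L) else 0)).Local v ×
          (UnitaryGroup.cmDatum L 1 (Matrix.of fun i j : Fin 1 => if i.val + j.val + 1 = 1 then (1 : L) else 0)).Local v))) ∧
      (∀ h : (UnitaryGroup.cmDatum L 2 (Matrix.of fun i j : Fin 2 => if i.val + j.val + 1 = 2 then (1 : L) else 0)).Local v ×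
          (UnitaryGroup.cmDatum L 1 (Matrix.of fun i j : Fin 1 => if i.val + j.val + 1 = 1 then (1 : L) else 0)).Local v,
        IsLocalGRegular L v h → ∃ T ∈ cartanAllH, ∃ s ∈ T, IsConj h s) ∧
      (∀ T ∈ cartanAllH, ∀ T' ∈ cartanAllH, ∀ s ∈ T, ∀ s' ∈ T', IsLocalGRegular L v s → IsConj s s' → T = T') := by
  obtain ⟨C, hM, hZ, hcpt, hcov, hirr⟩ := exists_cartanAllH L v hns
  refine ⟨C, hM, hZ, hcpt, fun h hreg => ?_, fun T hT T' hT' s hs s' hs' hsreg hconj => ?_⟩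
  · obtain ⟨T, hT, u, hu⟩ := hcov h hreg
    have hh : h ∈ Subgroup.centralizer ({h} : Set ((UnitaryGroup.cmDatum L 2 (Matrix.of fun i j : Fin 2 => if i.val + j.val + 1 = 2 then (1 : L) else 0)).Local v ×
        (UnitaryGroup.cmDatum L 1 (Matrix.of fun i j : Fin 1 => if i.val + j.val + 1 = 1 then (1 : L) else 0)).Local v)) := Subgroup.mem_centralizer_singleton_iff.2 rfl
    rw [hu, Subgroup.mem_map_equiv, MulAut.conj_symm_apply] at hh
    exact ⟨T, hT, u⁻¹ * h * u, hh, isConj_iff.2 ⟨u⁻¹, by group⟩⟩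
  · obtain ⟨γ₀, hγ₀, rfl⟩ := hZ T hT
    obtain ⟨γ₀', hγ₀', rfl⟩ := hZ T' hT'
    obtain ⟨c, rfl⟩ := isConj_iff.1 hconj
    have hs'reg : IsLocalGRegular L v (c * s * c⁻¹) := isLocalGRegular_of_isConj (L := L) hconj hsreg
    -- `Z_H(s) = Z_H(γ₀)`, `Z_H(c s c⁻¹) = Z_H(γ₀')`, `Z_H(c s c⁻¹) = Ad(c) Z_H(s)`
    have h1 := F0P3cStCharTSUpTrCartanFields.centralizer_eq_of_mem_centralizer_of_isLocalGRegular L v hγ₀ hs hsreg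
    have h2 := F0P3cStCharTSUpTrCartanFields.centralizer_eq_of_mem_centralizer_of_isLocalGRegular L v hγ₀' hs' hs'reg
    refine hirr _ hT _ hT' ⟨c, ?_⟩
    rw [← h1, ← h2, F0P3cStCharTSCartanEllProd.centralizer_singleton_conj_eq_map]

end Summit.HodgeConjecture.HodgeConjecture.Cruxes.H413.F0P3cStCharTSCartanAllH

end
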